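import Summits.ResolutionOfSingularities.ResolutionOfSingularities.Theorems.FrobeniusLadderFInjectiveMacaulayficationSingFullTower
import Summits.ResolutionOfSingularities.ResolutionOfSingularities.Theorems.FrobeniusLadderFInjectiveMacaulayficationRegularTowerInstanceE4
import HarnessLib

/-!
# THE NESTING LEMMA OF «ONE RECIPE, TWO STOPS»: a tower that ends REGULAR ends FULL — the R-stop height bounds the F-stop height (crux `FInjectiveMacaulayfication`
# stmt-ResolutionOfSingularities-15315, chain w45a; res-L1-w45a-plan-1 RULING R19.17 (L-d); seat res-L1-w45a-lead-1 g9; over `…RegularTower` (p634003), `…IntrinsicTowerRecipes` (p632743),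
# `…SingFullTower` (p638378) and res-L1-w45a-stub-1's first RR instance `…RegularTowerInstanceE4` (p635584))

[OURS · L1 W4.5a] Support file (`--supports stmt-ResolutionOfSingularities-15315 --as helper`); NOT a statement of any manuscript; def-free, fact-free, UNCONDITIONAL; generic in
the recipe. AI-written (AI review is weaker than expert review).

WHAT. Over a field of characteristic `p` a REGULAR local ring is FULL (`FTemkinClosedPoints.fullCl_of_isRegularLocalRing`: regular ⇒ domain ∧ CM ∧ Frobenius-closed parameter ideals —
already a tree theorem, no named fact needed; characteristic of the stalks from the structure morphism, `FTemkinClosedPoints.charP_stalk_of_over`). Hence, floor by floor: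
* §1 `fullCl_stalk_of_mem_regularLocus` — a regular point of a scheme over a char-`p` field has a FULL stalk;
* §2 ★ `recipeTowerFull_of_towerRegular (c) : ∀ n S (f : S ⟶ Spec k), RegTower.TowerRegular c p n S → IntrinsicTower.Recipes.RecipeTowerFull c p n S` — SAME recipe, SAME height: the
  REGULAR-stop tower predicate implies the FULL-stop one (induction on `n`; the structure morphism is composed down the tower); `exists_recipeTowerFull_of_exists_towerRegular` (∃-form:
  the F-stop height is at most the R-stop height); in particular for `c := RegTower.singCentre` (v44 «SING TOWERS»): on every floor where BOTH stubs speak (a FULL admissible floor of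
  `SingTowerConjecture` is in particular a CM admissible floor) the T-stub's tower dominates the F-stub's — `stub_singFullTower` and `stub_singTowerConjecture` are NESTED there, not
  independent; the same lemma serves every successor recipe (I-9 `tjCentre`, memory recipes through `exists_centre_of_tower_free`).
* §3 ★ FIRST KERNEL INSTANCE OF v44's F-SIDE TOWER PREDICATE: `recipeTowerFull_singCentre_two_G` — `RecipeTowerFull singCentre 2 2 G` for `G = {X₀X₁ + X₂³ + X₃³ + X₄³}` (char 2, any
  field), from res-L1-w45a-stub-1's `RegTower.InstanceE4.towerRegular_two_G` (Sing_red tower REGULAR at height 2) by §2. HONEST LABEL: `G` is FULL already at height 0 (E4″@G (F0) p625373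
  `fullCl_Spec_stalk_vertex`), so its F-stop height is 0 and this instance only exercises the nesting; the informative F-side instance (height 1 on the τ-floor chart of P2d4C, where
  Sing_red = non-FULL locus by res-L1-w45a-tri-2's data) is (L-a), next file.
HONEST CAVEATS: the converse nesting fails (FULL ⇏ regular); nothing here says any tower terminates; nothing of the crux is proved.
[folklore; cite: Matsumura1987, Thm. 14.3, Thm. 17.4, Thm. 17.8]
-/

-- single-problem summit: the doubled namespace component is forced
set_option linter.dupNamespace false

noncomputable section

open AlgebraicGeometry CategoryTheory CategoryTheory.Limits Literature.AlgebraicGeometry.Resolution TopologicalSpace IsLocalRing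

namespace Summit.ResolutionOfSingularities.ResolutionOfSingularities.Theorems.FInjectiveMacaulayfication.RegTower

open Summit.ResolutionOfSingularities.ResolutionOfSingularities.Theorems.FInjectiveMacaulayfication
open SliceableCentre IntrinsicTower IntrinsicTower.Recipes

/-! ## §1 Regular points over a field of characteristic `p` are FULL -/

/-- A REGULAR point of a scheme over a field of characteristic `p` has a FULL stalk. [cite: Matsumura1987, Thm. 14.3 and Thm. 17.4] -/
theorem fullCl_stalk_of_mem_regularLocus (p : ℕ) [Fact p.Prime] {k : Type} [Field k] [CharP k p] {S : Scheme.{0}} (f : S ⟶ Spec (.of k))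
    (s : S) (hs : s ∈ Scheme.regularLocus S) : FullCl p (S.presheaf.stalk s) := by
  rw [Scheme.mem_regularLocus] at hs
  haveI := hs
  haveI := FTemkinClosedPoints.charP_stalk_of_over p f (𝟙 S) s
  exact FTemkinClosedPoints.fullCl_of_isRegularLocalRing p _

/-! ## §2 ★ The nesting: a tower that ends REGULAR ends FULL, same recipe, same height -/

/-- ★ **NESTING LEMMA.** For every centre recipe `c`, every height `n` and every scheme `S` over a field of characteristic `p`:
`RegTower.TowerRegular c p n S → IntrinsicTower.Recipes.RecipeTowerFull c p n S`. Induction on `n`: at height `0` §1 pointwise; at height `n + 1` both predicates quantify over the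
same blowing ups `S₁ ⟶ S` along `c p S`, and `S₁` is again over `k`. [folklore; OURS] -/
theorem recipeTowerFull_of_towerRegular (p : ℕ) [Fact p.Prime] {k : Type} [Field k] [CharP k p] (c : CentreRecipe) :
    ∀ (n : ℕ) (S : Scheme.{0}) (_f : S ⟶ Spec (.of k)), TowerRegular c p n S → RecipeTowerFull c p n S := by
  intro n
  induction n with
  | zero =>
    intro S f h s
    exact fullCl_stalk_of_mem_regularLocus p f s (h s)
  | succ n ih =>
    intro S f h S₁ g hg
    exact ih S₁ (g ≫ f) (h S₁ g hg)

/-- **The F-stop height is at most the R-stop height** (∃-form of the nesting). [folklore; OURS] -/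
theorem exists_recipeTowerFull_of_exists_towerRegular (p : ℕ) [Fact p.Prime] {k : Type} [Field k] [CharP k p] (c : CentreRecipe)
    (S : Scheme.{0}) (f : S ⟶ Spec (.of k)) (h : ∃ n : ℕ, TowerRegular c p n S) : ∃ n : ℕ, RecipeTowerFull c p n S := by
  obtain ⟨n, hn⟩ := h
  exact ⟨n, recipeTowerFull_of_towerRegular p c n S f hn⟩

/-- The nesting for the recipe of v44 «SING TOWERS» (`RegTower.singCentre`), by name. [OURS] -/
theorem recipeTowerFull_singCentre_of_towerRegular (p : ℕ) [Fact p.Prime] {k : Type} [Field k] [CharP k p]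
    (n : ℕ) (S : Scheme.{0}) (f : S ⟶ Spec (.of k)) (h : TowerRegular singCentre p n S) : RecipeTowerFull singCentre p n S :=
  recipeTowerFull_of_towerRegular p singCentre n S f h

/-! ## §3 ★ First kernel instance of v44's F-side tower predicate (through the nesting) -/

/-- ★ **`RecipeTowerFull singCentre 2 2 G`** for `G = {X₀X₁ + X₂³ + X₃³ + X₄³} ⊂ 𝔸⁵` over any field of characteristic 2: the Sing_red tower of `G` is REGULAR at height 2
(res-L1-w45a-stub-1 `RegTower.InstanceE4.towerRegular_two_G`, p635584), hence FULL at height 2 by §2. HONEST LABEL: `G` itself is FULL (height-0 F-stop); this instance exercises the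
nesting lemma, it is not evidence for `SingFullTowerConjecture` beyond what p635584 already says. [OURS · instance] -/
theorem recipeTowerFull_singCentre_two_G (k : Type) [Field k] [CharP k 2] (f : MvPolynomial (Fin 5) k) (hf : f = MvPolynomial.X 0 * MvPolynomial.X 1 + MvPolynomial.X 2 ^ 3 + MvPolynomial.X 3 ^ 3 + MvPolynomial.X 4 ^ 3) :
    RecipeTowerFull singCentre 2 2 (Spec (.of (MvPolynomial (Fin 5) k ⧸ Ideal.span {f}))) := by
  haveI : Fact (Nat.Prime 2) := ⟨Nat.prime_two⟩
  exact recipeTowerFull_of_towerRegular 2 singCentre 2 _ (Spec.map (CommRingCat.ofHom (algebraMap k (MvPolynomial (Fin 5) k ⧸ Ideal.span {f}))))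
    (InstanceE4.towerRegular_two_G k f hf 2)

end Summit.ResolutionOfSingularities.ResolutionOfSingularities.Theorems.FInjectiveMacaulayfication.RegTower

end
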